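/-
Copyright (c) 2026 the pub-hodgecm-mathlib formalisation cell (harness21).  Prover seat hodgecm-mathlib-F0P3a-p03 (g25): N8-INNER road, brick (10)(C′)
«CORNER EP PACKAGE», FILE F-C (gluing the normalised one-place reading across the noncompact walls at the scalar corner; alternation; value).
-/
import Literature.NumberTheory.Rogawski1990.ArchCornerOnePlaceReading              -- ★ F-B (this seat): the one-place reading kit at `β₀`
import Literature.Analysis.Calculus.VandermondeDivisionThree                       -- ★ `exists_contDiff_eq_vandermonde_smul_of_forall_swap_ball`
import Literature.Analysis.Calculus.ClassGermThree                                -- ★ `norm_comp_perm` (sup balls about `0` are permutation stable)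
import HarnessLib

/-!
# Gluing the normalised one-place reading across the noncompact walls at the scalar corner (N8-INNER brick (10)(C′), FILE F-C)

Topic `NumberTheory/Rogawski1990`; namespace `Literature.NumberTheory.Rogawski1990`.  THEOREMS ONLY (no `def`, no instance, no notation, no axiom, no named
fact, no `sorry`); kernel lane `--supports stmt-HodgeConjecture-24833`.  Cell `pub/hodgecm-mathlib`, crux H413; road N8-INNER (owner LH2-plan (g1)), brick (10)(C′)
«CORNER EP PACKAGE» (F0P3a-p03 (g25)).  Count-neutral.

THE MATHEMATICS (`β₀ = (½,1,−½)`, one complex place `w`, centre `ζ = e^{iθ_ζ}`, one-place test function `f = fa∘(↑↑·)`, `R(x) = chartOrbGLoc … ∅ … f (θ_ζ•1 + x)`,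
`N(x) = e^{i(x₀−x₂)}Π(1 − e^{i(x_j−x_i)})`, `F = N·R`).
* §1 **GLUE.**  If the SPLIT one-place reading `chartOrbGLoc … {w} … f` vanishes at every Cayley coordinate `cw` (`cw₀ ≠ 0`) whose boost eigenvalues are
  `ε_B`-close to `ζ`, then on a ball `B(0, r)` the normalised compact reading `F` (which is `C^∞` off the two noncompact walls, ★ F-B) AGREES off the walls
  with a function `F̃` that is `C^∞` ON THE WHOLE BALL: the adapted ray-word jets of `F` have ZERO one-sided jumps across each noncompact wall at its simple
  points (★ (J) `hasOneSidedJump_onePlace_zero_of_split_vanishes`, fed by the vanishing near the Cayley point), the jets are bounded (★ F-B), so the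
  arrangement gluing theorem in adapted letters (★ `exists_contDiffOn_eqOn_offWalls02_12_of_adapted_ray_jumps`) applies.
* §2 **ALTERNATION.**  `A(x) := Σ_σ sign(σ) F̃(x∘σ)` is `C^∞` on the (permutation-stable) ball and alternating, hence `A = Vand • h₁` near `0` with `h₁`
  GLOBALLY smooth and symmetric (★ `exists_contDiff_eq_vandermonde_smul_of_forall_swap_ball`).
* §3 **THE SLOT SUM.**  At a REGULAR `x` near `0`: `Σ_σ R(x∘σ) = A(x)∕N(x) = h₁(x)∕u(x)` (`N` alternating, `N = u·π`, ★ F-B).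
* (the VALUE `12·h₁(0) = 6ℓ` is the sequel file `ArchCornerOnePlaceValue`).

## References
* [Rogawski1990] J. D. Rogawski, *Automorphic Representations of Unitary Groups in Three Variables*, Ann. of Math. Stud. 123 (1990), §8.2 p. 122, §8.4 pp. 126–127.
* [Shelstad1979] D. Shelstad, *Characters and inner forms of a quasi-split group over ℝ*, Compositio Math. 39 (1979), §4 Lemma 4.3 p. 25, Prop. 4.5 p. 26.
* [Bouaziz1994IntegralesOrbitales] A. Bouaziz, *Intégrales orbitales sur les algèbres de Lie réductives*, Invent. Math. 115 (1994), §3.2 (I₁)–(I₃) pp. 579–580.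
* [HarishChandra1975HARRG1] Harish-Chandra, *Harmonic analysis on real reductive groups I*, J. Funct. Anal. 19 (1975), §17 Lemma 17.5.
-/

set_option autoImplicit false

noncomputable section

open MeasureTheory MeasureTheory.Measure NumberField NumberField.InfinitePlace Matrix Complex Set Filter Topology Function Metric
open scoped MatrixGroups Matrix Real Classical ENNReal NNReal ContDiff
open Literature.NumberTheory.Automorphic Literature.NumberTheory.Automorphic.UnitaryGroup Literature.NumberTheory.Automorphic.ArchCartan
open Literature.NumberTheory.Automorphic.Shelstad1979.StableOrbitalIntegrals
open Literature.Geometry.ComplexHyperbolic.BallModel Literature.Analysis.Calculus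

namespace Literature.NumberTheory.Rogawski1990

/-! ## §1 Gluing across the noncompact walls -/

section Glue

variable (L : Type) [Field L] [NumberField L] [IsCMField L]
  [∀ v : {w : InfinitePlace L // IsComplex w}, MeasurableSpace ↥(archLocal L 3 (Matrix.diagonal ![(2 : L)⁻¹, 1, -(2 : L)⁻¹]) v)]
  [∀ v : {w : InfinitePlace L // IsComplex w}, BorelSpace ↥(archLocal L 3 (Matrix.diagonal ![(2 : L)⁻¹, 1, -(2 : L)⁻¹]) v)]
  [MeasurableSpace ↥(arch (↥(maximalRealSubfield L)) L (IsCMField.complexConj L) 3 (Matrix.diagonal ![(2 : L)⁻¹, 1, -(2 : L)⁻¹]))]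
  [BorelSpace ↥(arch (↥(maximalRealSubfield L)) L (IsCMField.complexConj L) 3 (Matrix.diagonal ![(2 : L)⁻¹, 1, -(2 : L)⁻¹]))]
  (ν'w : ∀ v : {w : InfinitePlace L // IsComplex w}, Measure ↥(archLocal L 3 (Matrix.diagonal ![(2 : L)⁻¹, 1, -(2 : L)⁻¹]) v))
  [∀ v, (ν'w v).IsHaarMeasure] [∀ v, (ν'w v).IsMulRightInvariant]
  (ν' : Measure ↥(arch (↥(maximalRealSubfield L)) L (IsCMField.complexConj L) 3 (Matrix.diagonal ![(2 : L)⁻¹, 1, -(2 : L)⁻¹]))) [ν'.IsHaarMeasure] [ν'.IsMulRightInvariant]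
  (hν : ν' = (Measure.pi ν'w).map (archPiEquivCM 3 L (Matrix.diagonal ![(2 : L)⁻¹, 1, -(2 : L)⁻¹])).symm)
  (w : {w : InfinitePlace L // IsComplex w})

open scoped Matrix.Norms.Operator

/-- The normaliser is `C^∞` on `ℝ³` (it is `u · π`, ★ F-B). [cite: Rogawski1990, §8.4 p. 126] -/
theorem contDiff_normaliser :
    ContDiff ℝ ∞ fun x : Fin 3 → ℝ => ((Circle.exp (x 0 - x 2) : Circle) : ℂ) *
      ((1 - ((Circle.exp (x 1 - x 0) : Circle) : ℂ)) * (1 - ((Circle.exp (x 2 - x 0) : Circle) : ℂ)) * (1 - ((Circle.exp (x 2 - x 1) : Circle) : ℂ))) := by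
  obtain ⟨u, hu, -, hN, -⟩ := exists_smooth_symmetric_unit_normaliser
  have h : (fun x : Fin 3 → ℝ => ((Circle.exp (x 0 - x 2) : Circle) : ℂ) *
      ((1 - ((Circle.exp (x 1 - x 0) : Circle) : ℂ)) * (1 - ((Circle.exp (x 2 - x 0) : Circle) : ℂ)) * (1 - ((Circle.exp (x 2 - x 1) : Circle) : ℂ)))) =
      fun x => u x * ((rootProduct x : ℝ) : ℂ) := funext hN
  rw [h]
  exact hu.mul (Complex.ofRealCLM.contDiff.comp contDiff_rootProduct)

/-- Translating the normalised reading from chart angles `cw = θ_ζ•1 + x` to corner coordinates `x`: the normaliser only sees differences.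
[cite: Rogawski1990, §8.4 p. 126] -/
theorem normalisedReading_comp_const_add (R : (Fin 3 → ℝ) → ℂ) (θζ : ℝ) :
    (fun z : Fin 3 → ℝ => (fun cw : Fin 3 → ℝ => ((Circle.exp (cw 0 - cw 2) : Circle) : ℂ) *
        ((1 - ((Circle.exp (cw 1 - cw 0) : Circle) : ℂ)) * (1 - ((Circle.exp (cw 2 - cw 0) : Circle) : ℂ)) * (1 - ((Circle.exp (cw 2 - cw 1) : Circle) : ℂ))) * R cw)
        ((fun _ : Fin 3 => θζ) + z)) =
      fun z => ((Circle.exp (z 0 - z 2) : Circle) : ℂ) *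
        ((1 - ((Circle.exp (z 1 - z 0) : Circle) : ℂ)) * (1 - ((Circle.exp (z 2 - z 0) : Circle) : ℂ)) * (1 - ((Circle.exp (z 2 - z 1) : Circle) : ℂ))) *
          R ((fun _ : Fin 3 => θζ) + z) := by
  funext z
  simp only [Pi.add_apply, add_sub_add_left_eq_sub]

/-- `‖e^{i(θ+s)} − ζ‖ ≤ |s|` for `ζ = e^{iθ}`. [cite: Rogawski1990, §8.4 p. 126] -/
theorem norm_cexp_add_mul_I_sub_le {ζ : Circle} {θζ : ℝ} (hζ : Circle.exp θζ = ζ) (s : ℝ) :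
    ‖Complex.exp (((θζ + s : ℝ) : ℂ) * I) - (ζ : ℂ)‖ ≤ |s| := by
  have hζ' : (ζ : ℂ) = Complex.exp ((θζ : ℂ) * I) := by rw [← hζ, Circle.coe_exp]
  rw [hζ', show ((θζ + s : ℝ) : ℂ) * I = (θζ : ℂ) * I + I * (s : ℂ) by push_cast; ring, Complex.exp_add, ← mul_sub_one, norm_mul,
    Complex.norm_exp_ofReal_mul_I, one_mul]
  simpa [Real.norm_eq_abs] using (Real.norm_exp_I_mul_ofReal_sub_one_le (x := s))

include hν in
/-- **GLUING THE NORMALISED ONE-PLACE READING ACROSS THE NONCOMPACT WALLS AT THE SCALAR CORNER.**  `β₀ = (½,1,−½)`, `w` a complex place, `ζ = e^{iθ_ζ}`, `f = fa∘(↑↑·)`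
a one-place test function.  IF the SPLIT reading `chartOrbGLoc L β₀ w {w} ν_w f cw` vanishes at every `cw` with `cw₀ ≠ 0` whose boost eigenvalues lie within `ε_B` of `ζ`, THEN
there are `r ∈ (0, 1∕4]` and `F̃`, `C^∞` on `ball 0 r`, equal OFF the two noncompact walls to the normalised compact reading
`x ↦ N(x) · chartOrbGLoc L β₀ w ∅ ν_w f (θ_ζ•1 + x)`.  (Zero jumps ★ (J) + jet bounds ★ F-B + the adapted-letters arrangement gluing ★.)
[cite: Shelstad1979, Lemma 4.3 p. 25, Prop. 4.5 p. 26] [cite: Bouaziz1994IntegralesOrbitales, §3.2 (I₁)–(I₃) pp. 579–580] [cite: Rogawski1990, §8.2 p. 122] -/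
theorem exists_smooth_glue_normalisedReading (ζ : Circle) {θζ : ℝ} (hζ : Circle.exp θζ = ζ)
    (f : ↥(archLocal L 3 (Matrix.diagonal ![(2 : L)⁻¹, 1, -(2 : L)⁻¹]) w) → ℂ) (fa : Matrix (Fin 3) (Fin 3) ℂ → ℂ) (hfa : ContDiff ℝ ∞ fa)
    (hf : ∀ g, f g = fa ((g : GL (Fin 3) ℂ) : Matrix (Fin 3) (Fin 3) ℂ)) (hfs : HasCompactSupport f)
    {εB : ℝ} (hεB : 0 < εB)
    (hvan : ∀ cw : Fin 3 → ℝ, cw 0 ≠ 0 → (∀ i, ‖boostEig cw i - (ζ : ℂ)‖ < εB) →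
      chartOrbGLoc L ![(2 : L)⁻¹, 1, -(2 : L)⁻¹] w ({w} : Finset {w : InfinitePlace L // IsComplex w}) (ν'w w) f cw = 0) :
    ∃ r : ℝ, 0 < r ∧ r ≤ 1 / 4 ∧ ∃ Ft : (Fin 3 → ℝ) → ℂ, ContDiffOn ℝ ∞ Ft (ball (0 : Fin 3 → ℝ) r) ∧
      ∀ x ∈ ball (0 : Fin 3 → ℝ) r, x 0 ≠ x 2 → x 1 ≠ x 2 →
        Ft x = ((Circle.exp (x 0 - x 2) : Circle) : ℂ) *
          ((1 - ((Circle.exp (x 1 - x 0) : Circle) : ℂ)) * (1 - ((Circle.exp (x 2 - x 0) : Circle) : ℂ)) * (1 - ((Circle.exp (x 2 - x 1) : Circle) : ℂ))) *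
            chartOrbGLoc L ![(2 : L)⁻¹, 1, -(2 : L)⁻¹] w (∅ : Finset {w : InfinitePlace L // IsComplex w}) (ν'w w) f ((fun _ : Fin 3 => θζ) + x) := by
  -- frame data of `β₀`
  have hβ := quasiSplitWeights_ne_zero L
  have hherm := transpose_map_cmConjRingHom_diagonal_quasiSplitWeights L
  have hwsp := mem_splitChartPlaces_quasiSplitWeights L w
  have hw0 : w ∉ (∅ : Finset {w : InfinitePlace L // IsComplex w}) := Finset.notMem_empty w
  have hS0 : ∀ v, v ∈ (∅ : Finset {w : InfinitePlace L // IsComplex w}) → v ∈ splitChartPlaces L ![(2 : L)⁻¹, 1, -(2 : L)⁻¹] :=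
    fun v h => absurd h (Finset.notMem_empty v)
  have hs02 : slotSign L ![(2 : L)⁻¹, 1, -(2 : L)⁻¹] w 0 ≠ slotSign L ![(2 : L)⁻¹, 1, -(2 : L)⁻¹] w 2 := fun h => by
    have := (slotSign_quasiSplitWeights_eq_iff L w 0 2).1 h; simp at this
  have hs12 : slotSign L ![(2 : L)⁻¹, 1, -(2 : L)⁻¹] w 1 ≠ slotSign L ![(2 : L)⁻¹, 1, -(2 : L)⁻¹] w 2 := fun h => by
    have := (slotSign_quasiSplitWeights_eq_iff L w 1 2).1 h; simp at this
  -- the radius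
  set r : ℝ := min (1 / 4) (εB / 2) with hrdef
  have hr : 0 < r := lt_min (by norm_num) (half_pos hεB)
  have hr4 : r ≤ 1 / 4 := min_le_left _ _
  have hrε : r < εB := (min_le_right _ _).trans_lt (half_lt_self hεB)
  -- names: the compact reading in chart angles `Fcw` and in corner coordinates `G`
  set Rζ : (Fin 3 → ℝ) → ℂ := fun x => chartOrbGLoc L ![(2 : L)⁻¹, 1, -(2 : L)⁻¹] w (∅ : Finset {w : InfinitePlace L // IsComplex w}) (ν'w w) f
    ((fun _ : Fin 3 => θζ) + x) with hRζ
  set Fcw : (Fin 3 → ℝ) → ℂ := fun cw => ((Circle.exp (cw 0 - cw 2) : Circle) : ℂ) *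
    ((1 - ((Circle.exp (cw 1 - cw 0) : Circle) : ℂ)) * (1 - ((Circle.exp (cw 2 - cw 0) : Circle) : ℂ)) * (1 - ((Circle.exp (cw 2 - cw 1) : Circle) : ℂ))) *
      chartOrbGLoc L ![(2 : L)⁻¹, 1, -(2 : L)⁻¹] w (∅ : Finset {w : InfinitePlace L // IsComplex w}) (ν'w w) f cw with hFcw
  set G : (Fin 3 → ℝ) → ℂ := fun x => ((Circle.exp (x 0 - x 2) : Circle) : ℂ) *
    ((1 - ((Circle.exp (x 1 - x 0) : Circle) : ℂ)) * (1 - ((Circle.exp (x 2 - x 0) : Circle) : ℂ)) * (1 - ((Circle.exp (x 2 - x 1) : Circle) : ℂ))) * Rζ x with hG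
  have hFG : (fun z => Fcw ((fun _ : Fin 3 => θζ) + z)) = G := by
    funext z
    simp only [hFcw, hG, hRζ, Pi.add_apply, add_sub_add_left_eq_sub]
  -- smoothness off the walls and jet bounds (★ F-B)
  have hGs : ContDiffOn ℝ ∞ G (ball (0 : Fin 3 → ℝ) r ∩ {x : Fin 3 → ℝ | x 0 ≠ x 2 ∧ x 1 ≠ x 2}) := by
    have hR := contDiffOn_chartOrbGLoc_quasiSplitWeights_ball_offWalls L w (ν'w w) hw0 fa hfa hf hfs hζ
    exact (contDiff_normaliser.contDiffOn.mul hR).mono (Set.inter_subset_inter_left _ (ball_subset_ball (hr4.trans (by norm_num))))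
  have hGb : ∀ x ∈ ball (0 : Fin 3 → ℝ) r, (x 0 = x 2 ∨ x 1 = x 2) → ∀ n : ℕ, ∃ C : ℝ,
      ∀ᶠ y in 𝓝 x, (y 0 ≠ y 2 ∧ y 1 ≠ y 2) → ‖iteratedFDeriv ℝ n G y‖ ≤ C := by
    intro x hx _ n
    obtain ⟨C, hC⟩ := exists_jetBound_normalisedReading_ball L w (ν'w w) hw0 fa hfa hf hfs hζ n
    refine ⟨C, ?_⟩
    filter_upwards [isOpen_ball.mem_nhds (ball_subset_ball hr4 hx)] with y hy hyw
    exact hC y hy hyw.1 hyw.2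
  -- adapted bases
  obtain ⟨b₀, hb₀⟩ := exists_basis_adaptedLetters 0 2 (by decide)
  obtain ⟨b₁, hb₁⟩ := exists_basis_adaptedLetters 1 2 (by decide)
  -- ZERO JUMPS from ★ (J): the generic step at a simple point of the wall `(i, 2)`
  have key : ∀ (i : Fin 3) (hi2 : i ≠ 2) (hs : slotSign L ![(2 : L)⁻¹, 1, -(2 : L)⁻¹] w i ≠ slotSign L ![(2 : L)⁻¹, 1, -(2 : L)⁻¹] w 2)
      (b : Module.Basis (Fin 3) ℝ (Fin 3 → ℝ))
      (hb : ∀ m : Fin 3, b m = if m = i then (Pi.single i 1 : Fin 3 → ℝ) - Pi.single 2 1 else if m = 2 then (Pi.single i 1 : Fin 3 → ℝ) + Pi.single 2 1 else Pi.single m 1),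
      ∀ x ∈ ball (0 : Fin 3 → ℝ) r, x i = x 2 → x (hcThird i 2) ≠ x 2 → ∀ (n : ℕ) (k : Fin n → Fin 3), ∃ l : ℂ,
        Tendsto (fun t : ℝ => iteratedFDeriv ℝ n G (x + t • ((Pi.single i 1 : Fin 3 → ℝ) - Pi.single 2 1)) fun m => b (k m)) (𝓝[>] 0) (𝓝 l) ∧
        Tendsto (fun t : ℝ => iteratedFDeriv ℝ n G (x + t • ((Pi.single i 1 : Fin 3 → ℝ) - Pi.single 2 1)) fun m => b (k m)) (𝓝[<] 0) (𝓝 l) := by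
    intro i hi2 hs b hb x hx hxi hxk n k
    -- the wall point in chart angles
    set pw : Fin 3 → ℝ := (fun _ : Fin 3 => θζ) + x with hpw
    have hpwi : pw i = pw 2 := by simp only [hpw, Pi.add_apply, hxi]
    have hxball : ∀ a b : Fin 3, |x a - x b| < 2 * Real.pi := fun a b =>
      abs_sub_lt_two_pi_of_mem_ball (ball_subset_ball (hr4.trans (by norm_num)) hx) a b
    have hpk : Circle.exp (pw (hcThird i 2)) ≠ Circle.exp (pw i) := by
      intro h
      have h' : Circle.exp (x (hcThird i 2)) = Circle.exp (x i) := by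
        have := congrArg (fun z => (Circle.exp θζ)⁻¹ * z) h
        simpa only [hpw, circleExp_const_add, inv_mul_cancel_left] using this
      rw [hxi] at h'
      exact circleExp_ne_of_abs_sub_lt_two_pi hxk (hxball _ _) h'
    -- the split reading vanishes near the Cayley point `q = (0, θ_ζ + x_k, θ_ζ + x_2)`
    have hxn : ∀ a, |x a| < r := by
      intro a
      have := mem_ball_zero_iff.1 hx
      rw [pi_norm_lt_iff hr] at this
      simpa only [Real.norm_eq_abs] using this a
    have hmid : (pw i + pw 2) / 2 = θζ + x 2 := by
      simp only [hpw, Pi.add_apply, hxi]; ring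
    have hq : ∀ j : Fin 3, ‖boostEig (![0, pw (hcThird i 2), (pw i + pw 2) / 2] : Fin 3 → ℝ) j - (ζ : ℂ)‖ < εB := by
      intro j
      rw [hmid, boostEig_eq_mul]
      have hk : pw (hcThird i 2) = θζ + x (hcThird i 2) := by simp only [hpw, Pi.add_apply]
      fin_cases j
      · simpa [hk] using (norm_cexp_add_mul_I_sub_le hζ (x 2)).trans_lt ((hxn 2).trans hrε)
      · simpa [hk] using (norm_cexp_add_mul_I_sub_le hζ (x (hcThird i 2))).trans_lt ((hxn _).trans hrε)
      · simpa [hk] using (norm_cexp_add_mul_I_sub_le hζ (x 2)).trans_lt ((hxn 2).trans hrε)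
    have hvanJ : ∀ᶠ cw in 𝓝[{cw : Fin 3 → ℝ | cw 0 ≠ 0}] (![0, pw (hcThird i 2), (pw i + pw 2) / 2] : Fin 3 → ℝ),
        chartOrbGLoc L ![(2 : L)⁻¹, 1, -(2 : L)⁻¹] w (insert w (∅ : Finset {w : InfinitePlace L // IsComplex w})) (ν'w w) f cw = 0 := by
      have hopen : IsOpen {cw : Fin 3 → ℝ | ∀ j : Fin 3, ‖boostEig cw j - (ζ : ℂ)‖ < εB} := by
        rw [show {cw : Fin 3 → ℝ | ∀ j : Fin 3, ‖boostEig cw j - (ζ : ℂ)‖ < εB} = ⋂ j : Fin 3, {cw | ‖boostEig cw j - (ζ : ℂ)‖ < εB} by ext; simp]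
        exact isOpen_iInter_of_finite fun j => isOpen_lt ((continuous_boostEig_apply j).sub continuous_const).norm continuous_const
      have h1 : ∀ᶠ cw in 𝓝[{cw : Fin 3 → ℝ | cw 0 ≠ 0}] (![0, pw (hcThird i 2), (pw i + pw 2) / 2] : Fin 3 → ℝ),
          ∀ j : Fin 3, ‖boostEig cw j - (ζ : ℂ)‖ < εB :=
        mem_nhdsWithin_of_mem_nhds (hopen.mem_nhds (by exact hq))
      filter_upwards [h1, self_mem_nhdsWithin] with cw hcw hcw0
      rw [Finset.insert_empty]
      exact hvan cw hcw0 hcw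
    -- ★ (J): zero one-sided jump of every adapted ray-word jet
    have hJ := hasOneSidedJump_onePlace_zero_of_split_vanishes L ![(2 : L)⁻¹, 1, -(2 : L)⁻¹] ν'w ν' hν hherm hβ ∅ hS0 w hw0 hwsp i 2 hi2 hs
      f fa hfa hf hfs pw hpwi hpk hvanJ n k
    obtain ⟨Lp, Lm, hLp, hLm, hpm⟩ := hJ
    have hLpm : Lp = Lm := sub_eq_zero.1 hpm
    -- the same ray function in corner coordinates
    have hfun : (fun ν : ℝ => iteratedFDeriv ℝ n Fcw (pw + ν • ((Pi.single i 1 : Fin 3 → ℝ) - Pi.single 2 1)) fun r => hcAdaptedVec w i 2 (w, k r) w) =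
        fun t : ℝ => iteratedFDeriv ℝ n G (x + t • ((Pi.single i 1 : Fin 3 → ℝ) - Pi.single 2 1)) fun m => b (k m) := by
      funext t
      have hw' : (fun r => hcAdaptedVec w i 2 (w, k r) w) = fun m => b (k m) := by
        funext m; rw [hb, hcAdaptedVec_self_apply]
      rw [hw', ← hFG, iteratedFDeriv_comp_add_left, hpw, add_assoc]
    refine ⟨Lp, ?_, ?_⟩
    · rw [← hfun]; exact hLp
    · rw [← hfun, hLpm]; exact hLm
  -- the two walls
  have hj₀ : ∀ x ∈ ball (0 : Fin 3 → ℝ) r, x 0 = x 2 → x 1 ≠ x 2 → ∀ (n : ℕ) (k : Fin n → Fin 3), ∃ l : ℂ,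
      Tendsto (fun t : ℝ => iteratedFDeriv ℝ n G (x + t • ((Pi.single 0 1 : Fin 3 → ℝ) - Pi.single 2 1)) fun m => b₀ (k m)) (𝓝[>] 0) (𝓝 l) ∧
      Tendsto (fun t : ℝ => iteratedFDeriv ℝ n G (x + t • ((Pi.single 0 1 : Fin 3 → ℝ) - Pi.single 2 1)) fun m => b₀ (k m)) (𝓝[<] 0) (𝓝 l) :=
    fun x hx h02 h12 n k => key 0 (by decide) hs02 b₀ hb₀ x hx h02 (by rw [hcThird_zero_two]; exact h12) n k
  have hj₁ : ∀ x ∈ ball (0 : Fin 3 → ℝ) r, x 1 = x 2 → x 0 ≠ x 2 → ∀ (n : ℕ) (k : Fin n → Fin 3), ∃ l : ℂ,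
      Tendsto (fun t : ℝ => iteratedFDeriv ℝ n G (x + t • ((Pi.single 1 1 : Fin 3 → ℝ) - Pi.single 2 1)) fun m => b₁ (k m)) (𝓝[>] 0) (𝓝 l) ∧
      Tendsto (fun t : ℝ => iteratedFDeriv ℝ n G (x + t • ((Pi.single 1 1 : Fin 3 → ℝ) - Pi.single 2 1)) fun m => b₁ (k m)) (𝓝[<] 0) (𝓝 l) :=
    fun x hx h12 h02 n k => key 1 (by decide) hs12 b₁ hb₁ x hx h12 (by rw [hcThird_one_two]; exact h02) n k
  -- glue
  obtain ⟨g, hg, hgG⟩ := exists_contDiffOn_eqOn_offWalls02_12_of_adapted_ray_jumps isOpen_ball hGs hGb b₀ b₁ hj₀ hj₁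
  exact ⟨r, hr, hr4, g, hg, fun x hx h02 h12 => hgG ⟨hx, h02, h12⟩⟩

end Glue

/-! ## §2 Alternation: `Σ_σ sign(σ)·F̃(x∘σ) = Vand • h₁` near `0` -/

section Alternation

/-- **A GLOBAL SMOOTH CUT-OFF OF THE GLUE AND ITS ALTERNATION.**  From `F̃` `C^∞` on `ball 0 r`: a globally smooth `H` equal to `F̃` on `ball 0 (r∕4)` (permutation-invariant cut-off ★
`exists_contDiff_prod_cutoff`), and a globally smooth SYMMETRIC `h₁` with `Σ_σ sign(σ)·H(x∘σ) = Vand(x) • h₁(x)` on `ball 0 (r∕2)` (the alternation is globally smooth and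
alternating; ★ `exists_contDiff_eq_vandermonde_smul_of_forall_swap_ball`). [cite: HarishChandra1975HARRG1, §17 Lemma 17.5] [cite: Rogawski1990, §8.4 p. 126] -/
theorem exists_cutoff_and_alternation_eq_vandermonde_smul {r : ℝ} (hr : 0 < r) {Ft : (Fin 3 → ℝ) → ℂ} (hFt : ContDiffOn ℝ ∞ Ft (ball (0 : Fin 3 → ℝ) r)) :
    ∃ H h₁ : (Fin 3 → ℝ) → ℂ, ContDiff ℝ ∞ H ∧ ContDiff ℝ ∞ h₁ ∧ (∀ (σ : Equiv.Perm (Fin 3)) (x : Fin 3 → ℝ), h₁ (x ∘ ⇑σ) = h₁ x) ∧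
      (∀ x ∈ ball (0 : Fin 3 → ℝ) (r / 4), H x = Ft x) ∧
      ∀ x ∈ ball (0 : Fin 3 → ℝ) (r / 2), (∑ σ : Equiv.Perm (Fin 3), ((Equiv.Perm.sign σ : ℤ) : ℂ) * H (x ∘ ⇑σ)) =
        ((x 0 - x 1) * (x 0 - x 2) * (x 1 - x 2)) • h₁ x := by
  have h0 : (fun _ : Fin 3 => (0 : ℝ)) = 0 := rfl
  -- the permutation-invariant cut-off and `H = χ • F̃`
  obtain ⟨χ, hχ, hχ1, hχsupp, hχσ⟩ := exists_contDiff_prod_cutoff 3 (0 : ℝ) (r' := r / 4) (r := r / 2) (by positivity) (by linarith)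
  rw [h0] at hχ1 hχsupp
  set H : (Fin 3 → ℝ) → ℂ := fun x => ((χ x : ℝ) : ℂ) * Ft x with hHdef
  have hH : ContDiff ℝ ∞ H :=
    contDiff_ofReal_mul_of_tsupport_subset isOpen_ball hχ (hχsupp.trans (ball_subset_ball (by linarith))) hFt
  have hHFt : ∀ x ∈ ball (0 : Fin 3 → ℝ) (r / 4), H x = Ft x := fun x hx => by
    simp only [hHdef, hχ1 x hx, Complex.ofReal_one, one_mul]
  -- the alternation `A` of `H`: globally smooth and alternating
  set A : (Fin 3 → ℝ) × ℝ → ℂ := fun q => ∑ σ : Equiv.Perm (Fin 3), ((Equiv.Perm.sign σ : ℤ) : ℂ) * H (q.1 ∘ ⇑σ) with hAdef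
  have hAs : ContDiff ℝ ∞ A := by
    refine ContDiff.sum fun σ _ => contDiff_const.mul (hH.comp ?_)
    exact (contDiff_pi.2 fun k => contDiff_apply ℝ ℝ (σ k)).comp contDiff_fst
  have hAanti : ∀ (i j : Fin 3), i ≠ j → ∀ (x : Fin 3 → ℝ) (p : ℝ), A (x ∘ ⇑(Equiv.swap i j), p) = -A (x, p) := by
    intro i j hij x p
    simp only [hAdef]
    have hre : ∀ σ : Equiv.Perm (Fin 3), (x ∘ ⇑(Equiv.swap i j)) ∘ ⇑σ = x ∘ ⇑(Equiv.swap i j * σ) := fun σ => rfl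
    simp_rw [hre]
    rw [← (Group.mulLeft_bijective (Equiv.swap i j)).sum_comp (fun τ : Equiv.Perm (Fin 3) => ((Equiv.Perm.sign τ : ℤ) : ℂ) * H (x ∘ ⇑τ))]
    rw [← Finset.sum_neg_distrib]
    refine Finset.sum_congr rfl fun σ _ => ?_
    rw [Equiv.Perm.sign_mul, Equiv.Perm.sign_swap hij]
    push_cast
    ring
  obtain ⟨h, hh, hhσ, hAh⟩ := exists_contDiff_eq_vandermonde_smul_of_forall_swap_ball (P := ℝ) (G := ℂ) A 0 hr
    (by rw [h0]; exact hAs.contDiffOn) (fun i j hij x _ p => hAanti i j hij x p)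
  rw [h0] at hAh
  refine ⟨H, fun x => h (x, 0), hH, hh.comp (contDiff_id.prodMk contDiff_const), fun σ x => hhσ σ x 0, hHFt, fun x hx => ?_⟩
  have := hAh x hx 0
  simpa only [hAdef] using this

end Alternation

/-! ## §3 The slot sum of the one-place readings on the regular set near the corner -/

section SlotSum

variable (L : Type) [Field L] [NumberField L] [IsCMField L] (w : {w : InfinitePlace L // IsComplex w})
  [MeasurableSpace ↥(archLocal L 3 (Matrix.diagonal ![(2 : L)⁻¹, 1, -(2 : L)⁻¹]) w)] [BorelSpace ↥(archLocal L 3 (Matrix.diagonal ![(2 : L)⁻¹, 1, -(2 : L)⁻¹]) w)]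
  (νw : Measure ↥(archLocal L 3 (Matrix.diagonal ![(2 : L)⁻¹, 1, -(2 : L)⁻¹]) w)) [νw.IsHaarMeasure] [νw.IsMulRightInvariant]

/-- **THE SLOT SUM IS `h₁ ∕ u` ON THE REGULAR SET NEAR THE CORNER.**  With `F̃ = N·R` off the walls on `ball 0 r`, `H = F̃` on `ball 0 (r∕4)`, `Σ_σ sign(σ)H(·∘σ) = Vand•h₁` on
`ball 0 (r∕2)` and `N = u·π` (★ F-B): at every REGULAR `x ∈ ball 0 (r∕4)`, `u(x) · Σ_σ R(x∘σ) = h₁(x)` (`N` is alternating, so `Σ_σ sign(σ)F̃(x∘σ) = N(x)·Σ_σ R(x∘σ)`;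
`π = Vand`). [cite: Rogawski1990, §8.2 p. 122; §8.4 p. 126] [cite: Shelstad1979, Lemma 4.2 p. 23] -/
theorem unit_mul_sum_perm_reading_eq (R Ft H h₁ u : (Fin 3 → ℝ) → ℂ) {r : ℝ} (hr : 0 < r)
    (hFtR : ∀ x ∈ ball (0 : Fin 3 → ℝ) r, x 0 ≠ x 2 → x 1 ≠ x 2 →
      Ft x = ((Circle.exp (x 0 - x 2) : Circle) : ℂ) *
        ((1 - ((Circle.exp (x 1 - x 0) : Circle) : ℂ)) * (1 - ((Circle.exp (x 2 - x 0) : Circle) : ℂ)) * (1 - ((Circle.exp (x 2 - x 1) : Circle) : ℂ))) * R x)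
    (hHFt : ∀ x ∈ ball (0 : Fin 3 → ℝ) (r / 4), H x = Ft x)
    (hA : ∀ x ∈ ball (0 : Fin 3 → ℝ) (r / 2), (∑ σ : Equiv.Perm (Fin 3), ((Equiv.Perm.sign σ : ℤ) : ℂ) * H (x ∘ ⇑σ)) =
      ((x 0 - x 1) * (x 0 - x 2) * (x 1 - x 2)) • h₁ x)
    (hN : ∀ x : Fin 3 → ℝ, ((Circle.exp (x 0 - x 2) : Circle) : ℂ) *
        ((1 - ((Circle.exp (x 1 - x 0) : Circle) : ℂ)) * (1 - ((Circle.exp (x 2 - x 0) : Circle) : ℂ)) * (1 - ((Circle.exp (x 2 - x 1) : Circle) : ℂ))) =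
      u x * ((rootProduct x : ℝ) : ℂ))
    {x : Fin 3 → ℝ} (hx : x ∈ ball (0 : Fin 3 → ℝ) (r / 4)) (hreg : Function.Injective x) :
    u x * ∑ σ : Equiv.Perm (Fin 3), R (x ∘ ⇑σ) = h₁ x := by
  have hπ : rootProduct x ≠ 0 := (rootProduct_ne_zero_iff x).2 ((injective_iff_of_fin_three x).1 hreg)
  -- each `x ∘ σ` is regular and in the same ball
  have hmem : ∀ σ : Equiv.Perm (Fin 3), x ∘ ⇑σ ∈ ball (0 : Fin 3 → ℝ) (r / 4) := fun σ => by
    rw [mem_ball_zero_iff, norm_comp_perm]; exact mem_ball_zero_iff.1 hx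
  have hoff : ∀ σ : Equiv.Perm (Fin 3), (x ∘ ⇑σ) 0 ≠ (x ∘ ⇑σ) 2 ∧ (x ∘ ⇑σ) 1 ≠ (x ∘ ⇑σ) 2 := fun σ =>
    ⟨fun e => absurd (σ.injective (hreg e)) (by decide), fun e => absurd (σ.injective (hreg e)) (by decide)⟩
  -- `sign(σ) H(x∘σ) = N(x) R(x∘σ)`
  have hterm : ∀ σ : Equiv.Perm (Fin 3), ((Equiv.Perm.sign σ : ℤ) : ℂ) * H (x ∘ ⇑σ) =
      (((Circle.exp (x 0 - x 2) : Circle) : ℂ) *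
        ((1 - ((Circle.exp (x 1 - x 0) : Circle) : ℂ)) * (1 - ((Circle.exp (x 2 - x 0) : Circle) : ℂ)) * (1 - ((Circle.exp (x 2 - x 1) : Circle) : ℂ)))) * R (x ∘ ⇑σ) := by
    intro σ
    rw [hHFt _ (hmem σ), hFtR _ (ball_subset_ball (by linarith) (hmem σ)) (hoff σ).1 (hoff σ).2,
      normaliser_comp_perm σ x]
    have hs : ((Equiv.Perm.sign σ : ℤ) : ℂ) * ((Equiv.Perm.sign σ : ℤ) : ℂ) = 1 := by
      rcases Int.units_eq_one_or (Equiv.Perm.sign σ) with h | h <;> simp [h]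
    linear_combination (((Circle.exp (x 0 - x 2) : Circle) : ℂ) *
        ((1 - ((Circle.exp (x 1 - x 0) : Circle) : ℂ)) * (1 - ((Circle.exp (x 2 - x 0) : Circle) : ℂ)) * (1 - ((Circle.exp (x 2 - x 1) : Circle) : ℂ))) * R (x ∘ ⇑σ)) * hs
  have hsum : (∑ σ : Equiv.Perm (Fin 3), ((Equiv.Perm.sign σ : ℤ) : ℂ) * H (x ∘ ⇑σ)) =
      u x * ((rootProduct x : ℝ) : ℂ) * ∑ σ : Equiv.Perm (Fin 3), R (x ∘ ⇑σ) := by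
    rw [Finset.mul_sum]
    exact Finset.sum_congr rfl fun σ _ => by rw [hterm σ, hN x]
  have hx2 : x ∈ ball (0 : Fin 3 → ℝ) (r / 2) := ball_subset_ball (by linarith) hx
  have key := hA x hx2
  rw [hsum, Complex.real_smul] at key
  -- cancel `π(x) = Vand(x) ≠ 0`
  have hV : ((rootProduct x : ℝ) : ℂ) = (((x 0 - x 1) * (x 0 - x 2) * (x 1 - x 2) : ℝ) : ℂ) := by simp [rootProduct]
  have hπc : ((rootProduct x : ℝ) : ℂ) ≠ 0 := Complex.ofReal_ne_zero.2 hπ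
  rw [← hV] at key
  have : ((rootProduct x : ℝ) : ℂ) * (u x * ∑ σ : Equiv.Perm (Fin 3), R (x ∘ ⇑σ) - h₁ x) = 0 := by
    linear_combination key
  rcases mul_eq_zero.1 this with h | h
  · exact absurd h hπc
  · exact sub_eq_zero.1 h

end SlotSum




end Literature.NumberTheory.Rogawski1990

end
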